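import Literature.Probability.RandomPlanarGeometry.RadialBesselHitting
import Literature.Probability.RandomPlanarGeometry.RadialBesselCocycle
import Literature.Probability.RandomPlanarGeometry.BrownianStrongMarkov
import Literature.Probability.Process.PathRegularization
import HarnessLib

/-!
# The strong Markov property of the radial Bessel process of SLE_κ

Topic `Probability/RandomPlanarGeometry`; theorems and auxiliary definitions, sequel of
`RadialBesselLifetime`/`RadialBesselHitting` (the process), `RadialBesselCocycle` (its deterministic
flow property) and `BrownianStrongMarkov` (the strong Markov property of the driving Brownian
motion). For the radial Bessel process `Y = Y^θ` of LSW (2002), (2.9)–(2.11),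
`dYₜ = cot(Yₜ/2) dt - √κ dBₜ`, with lifetime `T` (`sleLifetime`) and exit side
`ν ∈ {1, -1}` (`Y_T = 2π` / `Y_T = 0`; `sleExitSign`, LSW's `ν` of p. 5), we prove the identity
behind LSW's (2.10) "`h(θ, t) = E[h(Y_T^θ, t - T)]`" and "by (2.10), `t ↦ h(Yₜ^θ, s - t)` is a local
martingale" (proof of Lemma 2.2, p. 6), namely the **strong Markov property of `(T, ν)`**:

* `integral_remainingLifetime_eq` — for a stopping time `ρ ≤ σₙ` of the Brownian filtration
  (`σₙ` the exit time of the level-`n` flow, so that `ρ < T`), an `𝓕_ρ`-measurable `X` and a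
  bounded jointly measurable `Ψ`,
  `E[Ψ(X, T - ρ, ν)] = E[A_Ψ(X, Y_ρ)]`, `A_Ψ(x, y) := E^y[Ψ(x, T, ν)]` (`sideExpect`):
  conditionally on `𝓕_ρ`, the remaining lifetime and the exit side are those of an independent
  copy of the process started from `Y_ρ`;
* `integral_mul_indicator_exitsTop_comp_sub_eq` / `…_exitsBot_…` — the forms
  `E[G · 1_{Y_T = 2π} ψ(T - ρ)] = E[G · a_ψ(Y_ρ)]`, `a_ψ(y) = E^y[ψ(T); Y_T = 2π]`
  (`topExpect`; and the same through `0`, `botExpect`), for bounded `𝓕_ρ`-measurable `G`.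

Ingredients: the flow is a deterministic functional of the increments of the driving path
(`RadialBesselCocycle`: `…_congr`), restarting at `ρ` reproduces the flow after `ρ` with
`T = ρ + T'`, same side (`lifetime_eq_add`, `exitsTop_iff_shiftFam`); the post-`ρ` increments of
`B` are a Brownian motion independent of `𝓕_ρ` (`integral_brownianIncrAfter_eq_integral_integral`).
To evaluate flow functionals on the raw path space `ℝ≥0 → ℝ` (product σ-algebra, where the set of
continuous paths is not measurable) the driving path is first regularised
(`Process.pathRegularize`, which fixes continuous paths): `pathDriving κ w = √κ · pathRegularize w`.

## References

* G. F. Lawler, O. Schramm, W. Werner, *One-arm exponent for critical 2D percolation*, Electron.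
  J. Probab. 7 (2002), no. 2, §2: (2.7)–(2.10), proof of Lemma 2.2 (p. 6).
  [LawlerSchrammWernerEJP2002]
* G. F. Lawler, *Conformally Invariant Processes in the Plane*, AMS (2005), §1.11.
  [Lawler2005]
* J.-F. Le Gall, *Brownian Motion, Martingales, and Stochastic Calculus* (2016), Thm. 2.20,
  Thm. 8.7 (strong Markov property of solutions of SDEs). [Legall2016]
-/

noncomputable section

open MeasureTheory ProbabilityTheory Filter Topology Set
open scoped NNReal ENNReal

namespace Literature.Probability.RandomPlanarGeometry

namespace RadialLoewner

open Literature.Probability.Process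

/-! ### LSW's exit sign `ν` -/

section Sign

variable {Ω : Type*} {mΩ : MeasurableSpace Ω} {U : Ω → ℝ≥0 → ℝ}

variable (U) in
/-- **LSW's exit sign `ν`** (p. 5): `ν = 1` if the flow leaves `(0, 2π)` through `2π`
(`ExitsTop`, "the boundary of `W'` on `γ_ra` is on the right hand side"), `ν = -1` if through `0`
(`ExitsBot`); **junk value** `0` if neither (a null event for the SLE_κ process, `κ > 4`). Written
as a difference of indicators (the two events exclude each other). [cite: LawlerSchrammWernerEJP2002, §2 p. 5] -/
def exitSign (hc : ∀ ω, Continuous (U ω)) (θ : ℝ) (ω : Ω) : ℝ :=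
  {ω | ExitsTop U hc θ ω}.indicator 1 ω - {ω | ExitsBot U hc θ ω}.indicator 1 ω

variable (hc : ∀ ω, Continuous (U ω))

/-- `ν = 1` on a top exit. [folklore] -/
theorem exitSign_of_exitsTop {θ : ℝ} {ω : Ω} (h : ExitsTop U hc θ ω) : exitSign U hc θ ω = 1 := by
  have hb : ¬ExitsBot U hc θ ω := fun hb ↦ not_exitsTop_and_exitsBot hc θ ω ⟨h, hb⟩
  rw [exitSign, indicator_of_mem (show ω ∈ {ω | ExitsTop U hc θ ω} from h),
    indicator_of_notMem (show ω ∉ {ω | ExitsBot U hc θ ω} from hb)]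
  simp

/-- `ν = -1` on a bottom exit. [folklore] -/
theorem exitSign_of_exitsBot {θ : ℝ} {ω : Ω} (h : ExitsBot U hc θ ω) : exitSign U hc θ ω = -1 := by
  have ht : ¬ExitsTop U hc θ ω := fun ht ↦ not_exitsTop_and_exitsBot hc θ ω ⟨ht, h⟩
  rw [exitSign, indicator_of_notMem (show ω ∉ {ω | ExitsTop U hc θ ω} from ht),
    indicator_of_mem (show ω ∈ {ω | ExitsBot U hc θ ω} from h)]
  simp

/-- `ν = 0` (junk) if the flow exits neither way. [folklore] -/
theorem exitSign_of_not_not {θ : ℝ} {ω : Ω} (ht : ¬ExitsTop U hc θ ω) (hb : ¬ExitsBot U hc θ ω) :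
    exitSign U hc θ ω = 0 := by
  rw [exitSign, indicator_of_notMem (show ω ∉ {ω | ExitsTop U hc θ ω} from ht),
    indicator_of_notMem (show ω ∉ {ω | ExitsBot U hc θ ω} from hb), sub_zero]

/-- `ν = 1` iff the flow exits at the top. [folklore] -/
theorem exitSign_eq_one_iff (θ : ℝ) (ω : Ω) : exitSign U hc θ ω = 1 ↔ ExitsTop U hc θ ω := by
  refine ⟨fun h ↦ ?_, exitSign_of_exitsTop hc⟩
  by_contra ht
  by_cases hb : ExitsBot U hc θ ω
  · rw [exitSign_of_exitsBot hc hb] at h; norm_num at h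
  · rw [exitSign_of_not_not hc ht hb] at h; norm_num at h

/-- `ν = -1` iff the flow exits at the bottom. [folklore] -/
theorem exitSign_eq_neg_one_iff (θ : ℝ) (ω : Ω) : exitSign U hc θ ω = -1 ↔ ExitsBot U hc θ ω := by
  refine ⟨fun h ↦ ?_, exitSign_of_exitsBot hc⟩
  by_contra hb
  by_cases ht : ExitsTop U hc θ ω
  · rw [exitSign_of_exitsTop hc ht] at h; norm_num at h
  · rw [exitSign_of_not_not hc ht hb] at h; norm_num at h

/-- `|ν| ≤ 1`. [folklore] -/
theorem abs_exitSign_le (θ : ℝ) (ω : Ω) : |exitSign U hc θ ω| ≤ 1 := by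
  by_cases ht : ExitsTop U hc θ ω
  · rw [exitSign_of_exitsTop hc ht]; simp
  · by_cases hb : ExitsBot U hc θ ω
    · rw [exitSign_of_exitsBot hc hb]; simp
    · rw [exitSign_of_not_not hc ht hb]; simp

/-- Transport of the exit sign along equivalences of the exit events. [folklore] -/
theorem exitSign_eq_of_iff {Ω' : Type*} {U' : Ω' → ℝ≥0 → ℝ} (hc' : ∀ ω', Continuous (U' ω'))
    {θ θ' : ℝ} {ω : Ω} {ω' : Ω'} (htop : ExitsTop U' hc' θ' ω' ↔ ExitsTop U hc θ ω)
    (hbot : ExitsBot U' hc' θ' ω' ↔ ExitsBot U hc θ ω) : exitSign U' hc' θ' ω' = exitSign U hc θ ω := by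
  by_cases ht : ExitsTop U hc θ ω
  · rw [exitSign_of_exitsTop hc ht, exitSign_of_exitsTop hc' (htop.2 ht)]
  · by_cases hb : ExitsBot U hc θ ω
    · rw [exitSign_of_exitsBot hc hb, exitSign_of_exitsBot hc' (hbot.2 hb)]
    · rw [exitSign_of_not_not hc ht hb,
        exitSign_of_not_not hc' (fun h ↦ ht (htop.1 h)) (fun h ↦ hb (hbot.1 h))]

/-- The exit sign depends on the path only through its increments. [folklore] -/
theorem exitSign_congr {Ω' : Type*} {U' : Ω' → ℝ≥0 → ℝ} (hc' : ∀ ω', Continuous (U' ω'))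
    {ω : Ω} {ω' : Ω'} (hpath : ∀ u, U' ω' u - U' ω' 0 = U ω u - U ω 0) (θ : ℝ) :
    exitSign U' hc' θ ω' = exitSign U hc θ ω :=
  exitSign_eq_of_iff hc hc' (exitsTop_congr hc hc' hpath θ) (exitsBot_congr hc hc' hpath θ)

/-- The exit sign is that of the restarted flow (`r < T`). [folklore] -/
theorem exitSign_eq_shiftFam (θ : ℝ) (ω : Ω) {r : ℝ≥0} (hr : (r : WithTop ℝ≥0) < lifetime U hc θ ω) :
    exitSign U hc θ ω = exitSign (shiftFam U r) (continuous_shiftFam hc r) (arg U hc θ r ω) ω :=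
  (exitSign_eq_of_iff hc (continuous_shiftFam hc r) (exitsTop_iff_shiftFam hc θ ω hr).symm
    (exitsBot_iff_shiftFam hc θ ω hr).symm).symm

/-- The exit sign on the product space `ℝ × Ω` as a difference of indicators. [folklore] -/
theorem exitSign_prod_eq (p : ℝ × Ω) :
    exitSign U hc p.1 p.2 = {q : ℝ × Ω | ExitsTop U hc q.1 q.2}.indicator 1 p -
      {q : ℝ × Ω | ExitsBot U hc q.1 q.2}.indicator 1 p :=
  rfl

/-- **The exit sign is jointly measurable in `(θ, ω)`.** [folklore] -/
theorem measurable_exitSign_prod (hmeas : ∀ s, Measurable fun ω ↦ U ω s) :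
    Measurable fun p : ℝ × Ω ↦ exitSign U hc p.1 p.2 := by
  have h : (fun p : ℝ × Ω ↦ exitSign U hc p.1 p.2) =
      {q : ℝ × Ω | ExitsTop U hc q.1 q.2}.indicator 1 - {q : ℝ × Ω | ExitsBot U hc q.1 q.2}.indicator 1 :=
    funext fun p ↦ exitSign_prod_eq hc p
  rw [h]
  exact (measurable_one.indicator (measurableSet_exitsTop_prod hc hmeas)).sub
    (measurable_one.indicator (measurableSet_exitsBot_prod hc hmeas))

/-- The exit sign is measurable in `ω`. [folklore] -/
theorem measurable_exitSign (hmeas : ∀ s, Measurable fun ω ↦ U ω s) (θ : ℝ) :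
    Measurable fun ω ↦ exitSign U hc θ ω :=
  Measurable.comp (g := fun p : ℝ × Ω ↦ exitSign U hc p.1 p.2) (f := fun ω : Ω ↦ (θ, ω))
    (measurable_exitSign_prod hc hmeas) (measurable_const.prodMk measurable_id)

/-- A time before some `σₙ` is strictly before the lifetime (start in `(0, 2π)`). [folklore] -/
theorem coe_lt_lifetime_of_le_exitLevel {θ : ℝ} (hθ : θ ∈ Ioo 0 (2 * Real.pi)) {n : ℕ} {ω : Ω}
    {r : ℝ≥0} (hr : (r : WithTop ℝ≥0) ≤ exitLevel U hc n θ ω) : (r : WithTop ℝ≥0) < lifetime U hc θ ω := by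
  by_cases hT : lifetime U hc θ ω = ⊤
  · rw [hT]; exact WithTop.coe_lt_top r
  · exact hr.trans_lt (exitLevel_lt_lifetime hc hθ (lt_top_iff_ne_top.2 hT) n)

end Sign

/-! ### The universal flow on the raw path space -/

section PathSpace

/-- **The driving path of the universal flow**: `√κ` times the regularised path
(`Process.pathRegularize`, which is continuous for every raw path and leaves continuous paths
unchanged). For a Brownian path it is the SLE_κ driving function. [folklore] -/
def pathDriving (κ : ℝ≥0) (w : ℝ≥0 → ℝ) : ℝ≥0 → ℝ := fun t ↦ Real.sqrt κ * pathRegularize w t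

/-- The universal driving paths are continuous. [folklore] -/
theorem continuous_pathDriving (κ : ℝ≥0) : ∀ w : ℝ≥0 → ℝ, Continuous (pathDriving κ w) := fun w ↦
  continuous_const.mul (continuous_pathRegularize w)

/-- The universal driving path is measurable in the raw path at each time. [folklore] -/
theorem measurable_pathDriving (κ : ℝ≥0) (t : ℝ≥0) : Measurable fun w : ℝ≥0 → ℝ ↦ pathDriving κ w t :=
  (measurable_pathRegularize t).const_mul _

/-- On a continuous path the universal driving path is `√κ` times the path. [folklore] -/
theorem pathDriving_of_continuous {κ : ℝ≥0} {w : ℝ≥0 → ℝ} (hw : Continuous w) (t : ℝ≥0) :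
    pathDriving κ w t = Real.sqrt κ * w t := by
  rw [pathDriving, pathRegularize_eq_self_of_continuous hw]

/-- On the Brownian path the universal driving path is the SLE_κ driving function. [folklore] -/
theorem pathDriving_brownian (κ : ℝ≥0) (ω : ℝ≥0 → ℝ) (t : ℝ≥0) :
    pathDriving κ (fun u ↦ brownian u ω) t = sleDriving κ ω t := by
  rw [pathDriving_of_continuous (continuous_brownian ω), sleDriving_apply]

/-- The lifetime of the universal flow, read in `ℝ` (junk on `{T = ∞}`). [folklore] -/
def pathLifetimeReal (κ : ℝ≥0) (y : ℝ) (w : ℝ≥0 → ℝ) : ℝ :=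
  ((lifetime (pathDriving κ) (continuous_pathDriving κ) y w).untopA : ℝ≥0)

/-- The exit sign of the universal flow. [folklore] -/
def pathExitSign (κ : ℝ≥0) (y : ℝ) (w : ℝ≥0 → ℝ) : ℝ :=
  exitSign (pathDriving κ) (continuous_pathDriving κ) y w

/-- The real lifetime of the universal flow is jointly measurable in `(y, w)`. [folklore] -/
theorem measurable_pathLifetimeReal (κ : ℝ≥0) :
    Measurable fun p : ℝ × (ℝ≥0 → ℝ) ↦ pathLifetimeReal κ p.1 p.2 := by
  unfold pathLifetimeReal
  exact (measurable_lifetime_prod (continuous_pathDriving κ) (measurable_pathDriving κ)).untopA.coe_nnreal_real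

/-- The exit sign of the universal flow is jointly measurable in `(y, w)`. [folklore] -/
theorem measurable_pathExitSign (κ : ℝ≥0) :
    Measurable fun p : ℝ × (ℝ≥0 → ℝ) ↦ pathExitSign κ p.1 p.2 := by
  unfold pathExitSign
  exact measurable_exitSign_prod (continuous_pathDriving κ) (measurable_pathDriving κ)

end PathSpace

/-! ### The SLE_κ process: sign, real lifetime, joint measurability -/

section SLE

variable {κ : ℝ≥0} {n : ℕ} {θ : ℝ}

/-- **LSW's `ν` for the radial Bessel process of SLE_κ** started at `θ` (`1` on `{Y_T = 2π}`,
`-1` on `{Y_T = 0}`). [cite: LawlerSchrammWernerEJP2002, §2 p. 5] -/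
def sleExitSign (κ : ℝ≥0) (θ : ℝ) (ω : ℝ≥0 → ℝ) : ℝ :=
  exitSign (sleDriving κ) (continuous_sleDriving' κ) θ ω

/-- The SLE_κ driving function is measurable at each time. [folklore] -/
theorem measurable_sleDriving_apply (κ : ℝ≥0) (s : ℝ≥0) : Measurable fun ω ↦ sleDriving κ ω s :=
  (measurable_sleDriving_filtration κ s).mono (brownianFiltration.le s) le_rfl

/-- `{ν = 1} = {Y_T = 2π}`. [folklore] -/
theorem sleExitSign_eq_one_iff (ω : ℝ≥0 → ℝ) : sleExitSign κ θ ω = 1 ↔ ω ∈ sleExitsTop κ θ :=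
  exitSign_eq_one_iff _ θ ω

/-- `{ν = -1} = {Y_T = 0}`. [folklore] -/
theorem sleExitSign_eq_neg_one_iff (ω : ℝ≥0 → ℝ) : sleExitSign κ θ ω = -1 ↔ ω ∈ sleExitsBot κ θ :=
  exitSign_eq_neg_one_iff _ θ ω

/-- The sign is jointly measurable in `(θ, ω)`. [folklore] -/
theorem measurable_sleExitSign_prod (κ : ℝ≥0) :
    Measurable fun p : ℝ × (ℝ≥0 → ℝ) ↦ sleExitSign κ p.1 p.2 := by
  unfold sleExitSign
  exact measurable_exitSign_prod (continuous_sleDriving' κ) (measurable_sleDriving_apply κ)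

/-- The sign is measurable. [folklore] -/
theorem measurable_sleExitSign (κ : ℝ≥0) (θ : ℝ) : Measurable (sleExitSign κ θ) :=
  Measurable.comp (g := fun p : ℝ × (ℝ≥0 → ℝ) ↦ sleExitSign κ p.1 p.2) (f := fun ω : ℝ≥0 → ℝ ↦ (θ, ω))
    (measurable_sleExitSign_prod κ) (measurable_const.prodMk measurable_id)

/-- The real lifetime is jointly measurable in `(θ, ω)`. [folklore] -/
theorem measurable_sleLifetimeReal_prod (κ : ℝ≥0) :
    Measurable fun p : ℝ × (ℝ≥0 → ℝ) ↦ sleLifetimeReal κ p.1 p.2 := by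
  unfold sleLifetimeReal sleLifetime
  exact (measurable_lifetime_prod (continuous_sleDriving' κ)
    (measurable_sleDriving_apply κ)).untopA.coe_nnreal_real

/-- The universal driving path of the Brownian path has the increments of the SLE_κ driving
function. [folklore] -/
theorem pathDriving_brownian_sub (κ : ℝ≥0) (ω : ℝ≥0 → ℝ) (u : ℝ≥0) :
    pathDriving κ (fun u ↦ brownian u ω) u - pathDriving κ (fun u ↦ brownian u ω) 0 =
      sleDriving κ ω u - sleDriving κ ω 0 := by
  rw [pathDriving_brownian, pathDriving_brownian]

/-- **The universal flow on the Brownian path is the SLE_κ process**: real lifetime.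
[folklore] -/
theorem pathLifetimeReal_brownian (κ : ℝ≥0) (y : ℝ) (ω : ℝ≥0 → ℝ) :
    pathLifetimeReal κ y (fun u ↦ brownian u ω) = sleLifetimeReal κ y ω := by
  have h := lifetime_congr (ω := ω) (ω' := fun u ↦ brownian u ω) (continuous_sleDriving' κ)
    (continuous_pathDriving κ) (pathDriving_brownian_sub κ ω) y
  rw [pathLifetimeReal, sleLifetimeReal, sleLifetime, h]

/-- **The universal flow on the Brownian path is the SLE_κ process**: exit sign. [folklore] -/
theorem pathExitSign_brownian (κ : ℝ≥0) (y : ℝ) (ω : ℝ≥0 → ℝ) :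
    pathExitSign κ y (fun u ↦ brownian u ω) = sleExitSign κ y ω :=
  exitSign_congr (ω := ω) (ω' := fun u ↦ brownian u ω) (continuous_sleDriving' κ)
    (continuous_pathDriving κ) (pathDriving_brownian_sub κ ω) y

/-- The level-`n` flow is progressively measurable. [folklore] -/
theorem isStronglyProgressive_sleArgLevel (κ : ℝ≥0) (n : ℕ) (θ : ℝ) :
    IsStronglyProgressive brownianFiltration (sleArgLevel κ n θ) :=
  (stronglyAdapted_sleArgLevel κ n θ).isStronglyProgressive_of_continuous
    (continuous_sleArgLevel κ n θ)

/-- The level-`n` flow at a stopping time is `𝓕_ρ`-measurable. [folklore] -/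
theorem measurable_stoppedValue_sleArgLevel {ρ : (ℝ≥0 → ℝ) → WithTop ℝ≥0}
    (hρ : IsStoppingTime brownianFiltration ρ) :
    Measurable[hρ.measurableSpace] (stoppedValue (sleArgLevel κ n θ) ρ) :=
  measurable_stoppedValue (isStronglyProgressive_sleArgLevel κ n θ) hρ

/-- A stopping time before `σₙ` is a.s. finite (`κ > 4`). [folklore] -/
theorem ae_ne_top_of_le_sleExitLevel (hκ : 4 < κ) {ρ : (ℝ≥0 → ℝ) → WithTop ℝ≥0}
    (hρσ : ∀ ω, ρ ω ≤ sleExitLevel κ n θ ω) : ∀ᵐ ω ∂preWienerMeasure, ρ ω ≠ ⊤ := by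
  filter_upwards [ae_sleExitLevel_lt_top hκ n θ] with ω hω
  exact ((hρσ ω).trans_lt hω).ne

end SLE

/-! ### The pathwise restart identity at a random time -/

section Restart

variable {κ : ℝ≥0} {n : ℕ} {θ : ℝ}

/-- The increments of the post-`r` universal driving path built on `Z^ρ = B_{ρ+·} - B_ρ` (on
`{ρ = r}`) are those of the shifted SLE_κ driving function. [folklore] -/
theorem pathDriving_brownianIncrAfter_sub {ρ : (ℝ≥0 → ℝ) → WithTop ℝ≥0} {ω : ℝ≥0 → ℝ} {r : ℝ≥0}
    (hr : ρ ω = r) (u : ℝ≥0) :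
    pathDriving κ (fun u ↦ brownianIncrAfter ρ u ω) u - pathDriving κ (fun u ↦ brownianIncrAfter ρ u ω) 0 =
      shiftFam (sleDriving κ) r ω u - shiftFam (sleDriving κ) r ω 0 := by
  rw [pathDriving_of_continuous (continuous_brownianIncrAfter ρ ω),
    pathDriving_of_continuous (continuous_brownianIncrAfter ρ ω), brownianIncrAfter_of_eq_coe hr,
    brownianIncrAfter_zero, shiftFam_apply, shiftFam_apply, sleDriving_apply, sleDriving_apply,
    add_zero]
  ring

/-- **Pathwise restart identity.** On `{ρ = r}` with `r ≤ σₙ(θ)` and `T(θ) < ∞` (start inside the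
level-`n` interval): the remaining lifetime `T - r` and the exit sign of the SLE_κ process from
`θ` are the real lifetime and the exit sign of the universal flow started from `Y_r` and driven by
the post-`ρ` increments `Z^ρ`. [folklore] -/
theorem sleLifetimeReal_sub_eq_pathLifetimeReal
    (hθn : θ ∈ Ioo (2 * level n) (2 * Real.pi - 2 * level n))
    {ρ : (ℝ≥0 → ℝ) → WithTop ℝ≥0} {ω : ℝ≥0 → ℝ} {r : ℝ≥0} (hr : ρ ω = r)
    (hrσ : (r : WithTop ℝ≥0) ≤ sleExitLevel κ n θ ω) (hT : sleLifetime κ θ ω < ⊤) :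
    sleLifetimeReal κ θ ω - r =
        pathLifetimeReal κ (sleArgLevel κ n θ r ω) (fun u ↦ brownianIncrAfter ρ u ω) ∧
      sleExitSign κ θ ω = pathExitSign κ (sleArgLevel κ n θ r ω) (fun u ↦ brownianIncrAfter ρ u ω) := by
  have hθ : θ ∈ Ioo 0 (2 * Real.pi) :=
    ⟨lt_trans (by have := level_pos n; positivity) hθn.1, hθn.2.trans_le (by have := level_pos n; linarith)⟩
  have hrT : (r : WithTop ℝ≥0) < lifetime (sleDriving κ) (continuous_sleDriving' κ) θ ω :=
    coe_lt_lifetime_of_le_exitLevel (continuous_sleDriving' κ) hθ hrσ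
  have hy : sleArgLevel κ n θ r ω = arg (sleDriving κ) (continuous_sleDriving' κ) θ r ω :=
    (arg_eq_argLevel (continuous_sleDriving' κ) hrσ).symm
  have hpath := fun u ↦ pathDriving_brownianIncrAfter_sub (κ := κ) hr u
  -- lifetime: `T = r + T'` and `T'` is the path functional
  have hT1 := lifetime_eq_add (continuous_sleDriving' κ) θ ω hrT
  have hT2 : lifetime (pathDriving κ) (continuous_pathDriving κ)
      (arg (sleDriving κ) (continuous_sleDriving' κ) θ r ω) (fun u ↦ brownianIncrAfter ρ u ω) =
      lifetime (shiftFam (sleDriving κ) r) (continuous_shiftFam (continuous_sleDriving' κ) r)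
        (arg (sleDriving κ) (continuous_sleDriving' κ) θ r ω) ω :=
    lifetime_congr (continuous_shiftFam (continuous_sleDriving' κ) r) (continuous_pathDriving κ) hpath _
  constructor
  · obtain ⟨t₀, ht₀⟩ := WithTop.ne_top_iff_exists.1 hT.ne
    have ht₀' : lifetime (sleDriving κ) (continuous_sleDriving' κ) θ ω = t₀ := ht₀.symm
    have hT1' := hT1
    rw [ht₀', ← hT2] at hT1'
    -- `T'` is finite, `t₀ = r + s`
    have hne : lifetime (pathDriving κ) (continuous_pathDriving κ)
        (arg (sleDriving κ) (continuous_sleDriving' κ) θ r ω) (fun u ↦ brownianIncrAfter ρ u ω) ≠ ⊤ := by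
      intro htop; rw [htop, WithTop.add_top] at hT1'; exact WithTop.coe_ne_top hT1'
    obtain ⟨s, hs⟩ := WithTop.ne_top_iff_exists.1 hne
    rw [← hs, ← WithTop.coe_add, WithTop.coe_inj] at hT1'
    have hL : sleLifetimeReal κ θ ω = t₀ := sleLifetimeReal_of_eq_coe ht₀.symm
    have hR : pathLifetimeReal κ (sleArgLevel κ n θ r ω) (fun u ↦ brownianIncrAfter ρ u ω) = s := by
      rw [pathLifetimeReal, hy, ← hs]; rfl
    rw [hL, hR, hT1', NNReal.coe_add]
    ring
  · rw [sleExitSign, exitSign_eq_shiftFam (continuous_sleDriving' κ) θ ω hrT, pathExitSign, hy]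
    exact (exitSign_congr (continuous_shiftFam (continuous_sleDriving' κ) r) (continuous_pathDriving κ)
      hpath _).symm

end Restart

/-! ### The strong Markov property of `(T, ν)` -/

section StrongMarkov

variable {κ : ℝ≥0} {n : ℕ} {θ : ℝ}

/-- **The kernel of the strong Markov property**: `A_Ψ(x, y) = E^y[Ψ(x, T, ν)]`, the expectation
of a functional of the lifetime and the exit sign of the SLE_κ radial Bessel process started at
`y` (with a frozen parameter `x`). [folklore] -/
def sideExpect (κ : ℝ≥0) {𝒳 : Type*} (Ψ : 𝒳 → ℝ → ℝ → ℝ) (x : 𝒳) (y : ℝ) : ℝ :=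
  ∫ ω', Ψ x (sleLifetimeReal κ y ω') (sleExitSign κ y ω') ∂preWienerMeasure

/-- The kernel is jointly measurable in `(x, y)`. [folklore] -/
theorem measurable_sideExpect (κ : ℝ≥0) {𝒳 : Type*} [MeasurableSpace 𝒳] {Ψ : 𝒳 → ℝ → ℝ → ℝ}
    (hΨm : Measurable fun p : 𝒳 × ℝ × ℝ ↦ Ψ p.1 p.2.1 p.2.2) :
    Measurable fun p : 𝒳 × ℝ ↦ sideExpect κ Ψ p.1 p.2 := by
  haveI := isProbabilityMeasure_preWienerMeasure'
  unfold sideExpect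
  have hproj : Measurable fun q : (𝒳 × ℝ) × (ℝ≥0 → ℝ) ↦ (q.1.2, q.2) :=
    measurable_fst.snd.prodMk measurable_snd
  have hL : Measurable fun q : (𝒳 × ℝ) × (ℝ≥0 → ℝ) ↦ sleLifetimeReal κ q.1.2 q.2 :=
    Measurable.comp (g := fun p : ℝ × (ℝ≥0 → ℝ) ↦ sleLifetimeReal κ p.1 p.2)
      (f := fun q : (𝒳 × ℝ) × (ℝ≥0 → ℝ) ↦ (q.1.2, q.2)) (measurable_sleLifetimeReal_prod κ) hproj
  have hS : Measurable fun q : (𝒳 × ℝ) × (ℝ≥0 → ℝ) ↦ sleExitSign κ q.1.2 q.2 :=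
    Measurable.comp (g := fun p : ℝ × (ℝ≥0 → ℝ) ↦ sleExitSign κ p.1 p.2)
      (f := fun q : (𝒳 × ℝ) × (ℝ≥0 → ℝ) ↦ (q.1.2, q.2)) (measurable_sleExitSign_prod κ) hproj
  have hj : Measurable fun q : (𝒳 × ℝ) × (ℝ≥0 → ℝ) ↦
      Ψ q.1.1 (sleLifetimeReal κ q.1.2 q.2) (sleExitSign κ q.1.2 q.2) :=
    hΨm.comp (measurable_fst.fst.prodMk (hL.prodMk hS))
  exact hj.stronglyMeasurable.integral_prod_right' |>.measurable

/-- The kernel is bounded by the bound of `Ψ`. [folklore] -/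
theorem abs_sideExpect_le (κ : ℝ≥0) {𝒳 : Type*} {Ψ : 𝒳 → ℝ → ℝ → ℝ} {C : ℝ}
    (hΨb : ∀ x t ν, |Ψ x t ν| ≤ C) (x : 𝒳) (y : ℝ) : |sideExpect κ Ψ x y| ≤ C := by
  haveI := isProbabilityMeasure_preWienerMeasure'
  have hC : 0 ≤ C := (abs_nonneg _).trans (hΨb x 0 0)
  unfold sideExpect
  refine (abs_integral_le_integral_abs).trans ?_
  calc ∫ ω', |Ψ x (sleLifetimeReal κ y ω') (sleExitSign κ y ω')| ∂preWienerMeasure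
      ≤ ∫ _ω', C ∂preWienerMeasure :=
        integral_mono_of_nonneg (Eventually.of_forall fun _ ↦ abs_nonneg _) (integrable_const C)
          (Eventually.of_forall fun _ ↦ hΨb _ _ _)
    _ = C := by simp

/-- **Strong Markov property of the lifetime and the exit side** (the identity behind LSW's
(2.10)). Let `θ` lie in the level-`n` interval, let `ρ ≤ σₙ(θ)` be a stopping time of the raw
Brownian filtration, `X` an `𝓕_ρ`-measurable random variable and `Ψ(x, t, ν)` bounded and jointly
measurable. Then, with `T` the lifetime, `ν` the exit sign and `Y_ρ` the position at `ρ` of the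
SLE_κ radial Bessel process from `θ` (`κ > 4`, so that `T < ∞` a.s.),
`E[Ψ(X, T - ρ, ν)] = E[A_Ψ(X, Y_ρ)]` where `A_Ψ(x, y) = E^y[Ψ(x, T, ν)]`. Proof: pathwise,
`T - ρ` and `ν` are the lifetime and sign of the universal flow from `Y_ρ` driven by the post-`ρ`
increments (`sleLifetimeReal_sub_eq_pathLifetimeReal`); these increments are a Brownian motion
independent of `𝓕_ρ ∋ (X, Y_ρ)` (freezing formula at `ρ`, `BrownianStrongMarkov`); and on a
Brownian path the universal flow is the SLE_κ process. LSW (2002), proof of Lemma 2.2 ((2.7)–(2.10));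
Le Gall (2016), Thm. 8.7. [cite: LawlerSchrammWernerEJP2002, §2 proof of Lemma 2.2] -/
theorem integral_remainingLifetime_eq (hκ : 4 < κ)
    (hθn : θ ∈ Ioo (2 * level n) (2 * Real.pi - 2 * level n))
    {ρ : (ℝ≥0 → ℝ) → WithTop ℝ≥0} (hρ : IsStoppingTime brownianFiltration ρ)
    (hρσ : ∀ ω, ρ ω ≤ sleExitLevel κ n θ ω)
    {𝒳 : Type*} [MeasurableSpace 𝒳] {X : (ℝ≥0 → ℝ) → 𝒳} (hX : Measurable[hρ.measurableSpace] X)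
    {Ψ : 𝒳 → ℝ → ℝ → ℝ} (hΨm : Measurable fun p : 𝒳 × ℝ × ℝ ↦ Ψ p.1 p.2.1 p.2.2)
    {C : ℝ} (hΨb : ∀ x t ν, |Ψ x t ν| ≤ C) :
    ∫ ω, Ψ (X ω) (sleLifetimeReal κ θ ω - ((ρ ω).untopA : ℝ≥0)) (sleExitSign κ θ ω) ∂preWienerMeasure =
      ∫ ω, sideExpect κ Ψ (X ω) (stoppedValue (sleArgLevel κ n θ) ρ ω) ∂preWienerMeasure := by
  haveI := isProbabilityMeasure_preWienerMeasure'
  have hfin : ∀ᵐ ω ∂preWienerMeasure, ρ ω ≠ ⊤ := ae_ne_top_of_le_sleExitLevel hκ hρσ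
  -- the frozen data `(X, Y_ρ)` is `𝓕_ρ`-measurable; the path functional is bounded measurable
  have hXh : Measurable[hρ.measurableSpace]
      (fun ω ↦ (X ω, stoppedValue (sleArgLevel κ n θ) ρ ω)) :=
    hX.prodMk (measurable_stoppedValue_sleArgLevel hρ)
  have hproj : Measurable fun q : (𝒳 × ℝ) × (ℝ≥0 → ℝ) ↦ (q.1.2, q.2) :=
    measurable_fst.snd.prodMk measurable_snd
  have hL2 : Measurable fun q : (𝒳 × ℝ) × (ℝ≥0 → ℝ) ↦ pathLifetimeReal κ q.1.2 q.2 :=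
    Measurable.comp (g := fun p : ℝ × (ℝ≥0 → ℝ) ↦ pathLifetimeReal κ p.1 p.2)
      (f := fun q : (𝒳 × ℝ) × (ℝ≥0 → ℝ) ↦ (q.1.2, q.2)) (measurable_pathLifetimeReal κ) hproj
  have hS2 : Measurable fun q : (𝒳 × ℝ) × (ℝ≥0 → ℝ) ↦ pathExitSign κ q.1.2 q.2 :=
    Measurable.comp (g := fun p : ℝ × (ℝ≥0 → ℝ) ↦ pathExitSign κ p.1 p.2)
      (f := fun q : (𝒳 × ℝ) × (ℝ≥0 → ℝ) ↦ (q.1.2, q.2)) (measurable_pathExitSign κ) hproj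
  have hFm : Measurable (Function.uncurry fun (x : 𝒳 × ℝ) (w : ℝ≥0 → ℝ) ↦
      Ψ x.1 (pathLifetimeReal κ x.2 w) (pathExitSign κ x.2 w)) :=
    hΨm.comp (measurable_fst.fst.prodMk (hL2.prodMk hS2))
  have hFb : ∀ (x : 𝒳 × ℝ) (w : ℝ≥0 → ℝ),
      |Ψ x.1 (pathLifetimeReal κ x.2 w) (pathExitSign κ x.2 w)| ≤ C := fun x w ↦ hΨb _ _ _
  -- (1) pathwise restart identity, almost surely
  have hae : (fun ω ↦ Ψ (X ω) (sleLifetimeReal κ θ ω - ((ρ ω).untopA : ℝ≥0)) (sleExitSign κ θ ω))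
      =ᵐ[preWienerMeasure] fun ω ↦
        Ψ (X ω) (pathLifetimeReal κ (stoppedValue (sleArgLevel κ n θ) ρ ω) fun u ↦ brownianIncrAfter ρ u ω)
          (pathExitSign κ (stoppedValue (sleArgLevel κ n θ) ρ ω) fun u ↦ brownianIncrAfter ρ u ω) := by
    filter_upwards [hfin, ae_sleLifetime_lt_top (κ := κ) (θ := θ) hκ] with ω hρω hTω
    obtain ⟨r, hr⟩ := WithTop.ne_top_iff_exists.1 hρω
    have hrσ : (r : WithTop ℝ≥0) ≤ sleExitLevel κ n θ ω := by rw [hr]; exact hρσ ω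
    obtain ⟨h1, h2⟩ := sleLifetimeReal_sub_eq_pathLifetimeReal hθn hr.symm hrσ hTω
    have hY : stoppedValue (sleArgLevel κ n θ) ρ ω = sleArgLevel κ n θ r ω := by
      rw [stoppedValue, ← hr]; rfl
    have hru : (((ρ ω).untopA : ℝ≥0) : ℝ) = r := by rw [← hr]; rfl
    rw [hY, ← h1, ← h2, hru]
  -- (2) freezing formula at `ρ`
  have hfreeze := integral_brownianIncrAfter_eq_integral_integral hρ hfin hXh hFm hFb
  -- (3) on a Brownian path the universal flow is the SLE_κ process
  calc ∫ ω, Ψ (X ω) (sleLifetimeReal κ θ ω - ((ρ ω).untopA : ℝ≥0)) (sleExitSign κ θ ω) ∂preWienerMeasure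
      = ∫ ω, Ψ (X ω)
          (pathLifetimeReal κ (stoppedValue (sleArgLevel κ n θ) ρ ω) fun u ↦ brownianIncrAfter ρ u ω)
          (pathExitSign κ (stoppedValue (sleArgLevel κ n θ) ρ ω) fun u ↦ brownianIncrAfter ρ u ω)
          ∂preWienerMeasure := integral_congr_ae hae
    _ = ∫ ω, ∫ ω', Ψ (X ω)
          (pathLifetimeReal κ (stoppedValue (sleArgLevel κ n θ) ρ ω) fun u ↦ brownian u ω')
          (pathExitSign κ (stoppedValue (sleArgLevel κ n θ) ρ ω) fun u ↦ brownian u ω')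
          ∂preWienerMeasure ∂preWienerMeasure := hfreeze
    _ = ∫ ω, sideExpect κ Ψ (X ω) (stoppedValue (sleArgLevel κ n θ) ρ ω) ∂preWienerMeasure := by
        refine integral_congr_ae (Eventually.of_forall fun ω ↦ ?_)
        simp only [pathLifetimeReal_brownian, pathExitSign_brownian, sideExpect]

/-- The indicator of `{ν = 1}` as a function of the sign. [folklore] -/
def topInd (ν : ℝ) : ℝ := if ν = 1 then 1 else 0

/-- The indicator of `{ν = -1}` as a function of the sign. [folklore] -/
def botInd (ν : ℝ) : ℝ := if ν = -1 then 1 else 0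

/-- `topInd` is measurable. [folklore] -/
theorem measurable_topInd : Measurable topInd :=
  Measurable.ite (measurableSet_singleton 1) measurable_const measurable_const

/-- `botInd` is measurable. [folklore] -/
theorem measurable_botInd : Measurable botInd :=
  Measurable.ite (measurableSet_singleton (-1)) measurable_const measurable_const

/-- `topInd ν(ω)` is the indicator of `{Y_T = 2π}`. [folklore] -/
theorem topInd_sleExitSign (κ : ℝ≥0) (θ : ℝ) (ω : ℝ≥0 → ℝ) :
    topInd (sleExitSign κ θ ω) = (sleExitsTop κ θ).indicator 1 ω := by
  unfold topInd
  by_cases h : ω ∈ sleExitsTop κ θ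
  · rw [if_pos ((sleExitSign_eq_one_iff ω).2 h), indicator_of_mem h]; rfl
  · rw [if_neg (fun h' ↦ h ((sleExitSign_eq_one_iff ω).1 h')), indicator_of_notMem h]

/-- `botInd ν(ω)` is the indicator of `{Y_T = 0}`. [folklore] -/
theorem botInd_sleExitSign (κ : ℝ≥0) (θ : ℝ) (ω : ℝ≥0 → ℝ) :
    botInd (sleExitSign κ θ ω) = (sleExitsBot κ θ).indicator 1 ω := by
  unfold botInd
  by_cases h : ω ∈ sleExitsBot κ θ
  · rw [if_pos ((sleExitSign_eq_neg_one_iff ω).2 h), indicator_of_mem h]; rfl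
  · rw [if_neg (fun h' ↦ h ((sleExitSign_eq_neg_one_iff ω).1 h')), indicator_of_notMem h]

/-- **`a_ψ(y) = E^y[ψ(T); Y_T = 2π]`**, the expectation of a function of the lifetime on the top
exit (LSW's `h(θ, t)` is built from these with `ψ = 1_{· ≥ t}` and `ψ = u(t - ·)`, (2.7)–(2.10)).
[cite: LawlerSchrammWernerEJP2002, §2 (2.10)] -/
def topExpect (κ : ℝ≥0) (ψ : ℝ → ℝ) (y : ℝ) : ℝ :=
  ∫ ω', (sleExitsTop κ y).indicator (fun ω' ↦ ψ (sleLifetimeReal κ y ω')) ω' ∂preWienerMeasure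

/-- **`b_ψ(y) = E^y[ψ(T); Y_T = 0]`**, the same on the bottom exit. [cite: LawlerSchrammWernerEJP2002, §2 (2.10)] -/
def botExpect (κ : ℝ≥0) (ψ : ℝ → ℝ) (y : ℝ) : ℝ :=
  ∫ ω', (sleExitsBot κ y).indicator (fun ω' ↦ ψ (sleLifetimeReal κ y ω')) ω' ∂preWienerMeasure

/-- `topExpect` as a `sideExpect`. [folklore] -/
theorem sideExpect_top (κ : ℝ≥0) (ψ : ℝ → ℝ) (g y : ℝ) :
    sideExpect κ (fun (g : ℝ) t ν ↦ g * (ψ t * topInd ν)) g y = g * topExpect κ ψ y := by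
  unfold sideExpect topExpect
  rw [← integral_const_mul]
  refine integral_congr_ae (Eventually.of_forall fun ω' ↦ ?_)
  simp only [topInd_sleExitSign]
  by_cases h : ω' ∈ sleExitsTop κ y
  · simp [indicator_of_mem h]
  · simp [indicator_of_notMem h]

/-- `botExpect` as a `sideExpect`. [folklore] -/
theorem sideExpect_bot (κ : ℝ≥0) (ψ : ℝ → ℝ) (g y : ℝ) :
    sideExpect κ (fun (g : ℝ) t ν ↦ g * (ψ t * botInd ν)) g y = g * botExpect κ ψ y := by
  unfold sideExpect botExpect
  rw [← integral_const_mul]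
  refine integral_congr_ae (Eventually.of_forall fun ω' ↦ ?_)
  simp only [botInd_sleExitSign]
  by_cases h : ω' ∈ sleExitsBot κ y
  · simp [indicator_of_mem h]
  · simp [indicator_of_notMem h]

/-- `topExpect κ ψ` is measurable (`ψ` measurable). [folklore] -/
theorem measurable_topExpect (κ : ℝ≥0) {ψ : ℝ → ℝ} (hψ : Measurable ψ) : Measurable (topExpect κ ψ) := by
  have hΨ : Measurable fun p : ℝ × ℝ × ℝ ↦ p.1 * (ψ p.2.1 * topInd p.2.2) :=
    measurable_fst.mul ((hψ.comp measurable_snd.fst).mul (measurable_topInd.comp measurable_snd.snd))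
  have h := (measurable_sideExpect κ (Ψ := fun (g : ℝ) t ν ↦ g * (ψ t * topInd ν)) hΨ).comp
    ((measurable_const (a := (1 : ℝ))).prodMk measurable_id)
  have heq : (fun y ↦ sideExpect κ (fun (g : ℝ) t ν ↦ g * (ψ t * topInd ν)) 1 y) = topExpect κ ψ := by
    funext y; rw [sideExpect_top, one_mul]
  rw [← heq]; exact h

/-- `botExpect κ ψ` is measurable (`ψ` measurable). [folklore] -/
theorem measurable_botExpect (κ : ℝ≥0) {ψ : ℝ → ℝ} (hψ : Measurable ψ) : Measurable (botExpect κ ψ) := by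
  have hΨ : Measurable fun p : ℝ × ℝ × ℝ ↦ p.1 * (ψ p.2.1 * botInd p.2.2) :=
    measurable_fst.mul ((hψ.comp measurable_snd.fst).mul (measurable_botInd.comp measurable_snd.snd))
  have h := (measurable_sideExpect κ (Ψ := fun (g : ℝ) t ν ↦ g * (ψ t * botInd ν)) hΨ).comp
    ((measurable_const (a := (1 : ℝ))).prodMk measurable_id)
  have heq : (fun y ↦ sideExpect κ (fun (g : ℝ) t ν ↦ g * (ψ t * botInd ν)) 1 y) = botExpect κ ψ := by
    funext y; rw [sideExpect_bot, one_mul]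
  rw [← heq]; exact h

/-- `|topExpect κ ψ y| ≤ C` if `|ψ| ≤ C`. [folklore] -/
theorem abs_topExpect_le (κ : ℝ≥0) {ψ : ℝ → ℝ} {C : ℝ} (hψb : ∀ t, |ψ t| ≤ C) (y : ℝ) :
    |topExpect κ ψ y| ≤ C := by
  haveI := isProbabilityMeasure_preWienerMeasure'
  have hC : 0 ≤ C := (abs_nonneg _).trans (hψb 0)
  unfold topExpect
  refine abs_integral_le_integral_abs.trans ?_
  calc ∫ ω', |(sleExitsTop κ y).indicator (fun ω' ↦ ψ (sleLifetimeReal κ y ω')) ω'| ∂preWienerMeasure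
      ≤ ∫ _ω', C ∂preWienerMeasure :=
        integral_mono_of_nonneg (Eventually.of_forall fun _ ↦ abs_nonneg _) (integrable_const C)
          (Eventually.of_forall fun ω' ↦ by
            change |(sleExitsTop κ y).indicator (fun ω' ↦ ψ (sleLifetimeReal κ y ω')) ω'| ≤ C
            by_cases h : ω' ∈ sleExitsTop κ y
            · rw [indicator_of_mem h]; exact hψb _
            · rw [indicator_of_notMem h, abs_zero]; exact hC)
    _ = C := by simp

/-- `|botExpect κ ψ y| ≤ C` if `|ψ| ≤ C`. [folklore] -/
theorem abs_botExpect_le (κ : ℝ≥0) {ψ : ℝ → ℝ} {C : ℝ} (hψb : ∀ t, |ψ t| ≤ C) (y : ℝ) :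
    |botExpect κ ψ y| ≤ C := by
  haveI := isProbabilityMeasure_preWienerMeasure'
  have hC : 0 ≤ C := (abs_nonneg _).trans (hψb 0)
  unfold botExpect
  refine abs_integral_le_integral_abs.trans ?_
  calc ∫ ω', |(sleExitsBot κ y).indicator (fun ω' ↦ ψ (sleLifetimeReal κ y ω')) ω'| ∂preWienerMeasure
      ≤ ∫ _ω', C ∂preWienerMeasure :=
        integral_mono_of_nonneg (Eventually.of_forall fun _ ↦ abs_nonneg _) (integrable_const C)
          (Eventually.of_forall fun ω' ↦ by
            change |(sleExitsBot κ y).indicator (fun ω' ↦ ψ (sleLifetimeReal κ y ω')) ω'| ≤ C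
            by_cases h : ω' ∈ sleExitsBot κ y
            · rw [indicator_of_mem h]; exact hψb _
            · rw [indicator_of_notMem h, abs_zero]; exact hC)
    _ = C := by simp

/-- **Strong Markov property, top exit**: for a stopping time `ρ ≤ σₙ(θ)`, a bounded
`𝓕_ρ`-measurable `G` and a bounded measurable `ψ`,
`E[G · 1_{Y_T = 2π} ψ(T - ρ)] = E[G · a_ψ(Y_ρ)]`, `a_ψ(y) = E^y[ψ(T); Y_T = 2π]`. With `ψ = u(t - ·)`
this is the top half of LSW's (2.10); with `G` ranging over indicators of `𝓕_ρ`-events it says that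
`a_ψ(Y_ρ)` is the conditional expectation of `1_{Y_T = 2π} ψ(T - ρ)` given `𝓕_ρ`.
[cite: LawlerSchrammWernerEJP2002, §2 (2.10)] -/
theorem integral_mul_indicator_exitsTop_comp_sub_eq (hκ : 4 < κ)
    (hθn : θ ∈ Ioo (2 * level n) (2 * Real.pi - 2 * level n))
    {ρ : (ℝ≥0 → ℝ) → WithTop ℝ≥0} (hρ : IsStoppingTime brownianFiltration ρ)
    (hρσ : ∀ ω, ρ ω ≤ sleExitLevel κ n θ ω)
    {G : (ℝ≥0 → ℝ) → ℝ} (hG : Measurable[hρ.measurableSpace] G) {C' : ℝ} (hGb : ∀ ω, |G ω| ≤ C')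
    {ψ : ℝ → ℝ} (hψm : Measurable ψ) {C : ℝ} (hψb : ∀ t, |ψ t| ≤ C) :
    ∫ ω, G ω * (sleExitsTop κ θ).indicator
        (fun ω ↦ ψ (sleLifetimeReal κ θ ω - ((ρ ω).untopA : ℝ≥0))) ω ∂preWienerMeasure =
      ∫ ω, G ω * topExpect κ ψ (stoppedValue (sleArgLevel κ n θ) ρ ω) ∂preWienerMeasure := by
  have hC' : 0 ≤ C' := (abs_nonneg _).trans (hGb fun _ ↦ 0)
  -- clamp the frozen variable to make the functional bounded
  set Ψ : ℝ → ℝ → ℝ → ℝ := fun g t ν ↦ max (-C') (min C' g) * (ψ t * topInd ν) with hΨ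
  have hΨm : Measurable fun p : ℝ × ℝ × ℝ ↦ Ψ p.1 p.2.1 p.2.2 :=
    (measurable_const.max (measurable_const.min measurable_fst)).mul
      ((hψm.comp measurable_snd.fst).mul (measurable_topInd.comp measurable_snd.snd))
  have hclamp : ∀ g : ℝ, |max (-C') (min C' g)| ≤ C' := fun g ↦
    abs_le.2 ⟨le_max_left _ _, max_le (by linarith) (min_le_left _ _)⟩
  have hC : 0 ≤ C := (abs_nonneg _).trans (hψb 0)
  have hΨb : ∀ g t ν, |Ψ g t ν| ≤ C' * C := by
    intro g t ν
    simp only [hΨ, abs_mul]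
    have h1 : |topInd ν| ≤ 1 := by unfold topInd; split_ifs <;> simp
    calc |max (-C') (min C' g)| * (|ψ t| * |topInd ν|) ≤ C' * (C * 1) :=
          mul_le_mul (hclamp g) (mul_le_mul (hψb t) h1 (abs_nonneg _) hC)
            (mul_nonneg (abs_nonneg _) (abs_nonneg _)) hC'
      _ = C' * C := by ring
  have h := integral_remainingLifetime_eq hκ hθn hρ hρσ hG hΨm hΨb
  have hGclamp : ∀ ω, max (-C') (min C' (G ω)) = G ω := fun ω ↦ by
    have := abs_le.1 (hGb ω)
    rw [min_eq_right this.2, max_eq_right this.1]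
  have hL : (fun ω ↦ Ψ (G ω) (sleLifetimeReal κ θ ω - ((ρ ω).untopA : ℝ≥0)) (sleExitSign κ θ ω)) =
      fun ω ↦ G ω * (sleExitsTop κ θ).indicator
        (fun ω ↦ ψ (sleLifetimeReal κ θ ω - ((ρ ω).untopA : ℝ≥0))) ω := by
    funext ω
    simp only [hΨ, hGclamp, topInd_sleExitSign]
    by_cases hω : ω ∈ sleExitsTop κ θ
    · simp [indicator_of_mem hω]
    · simp [indicator_of_notMem hω]
  have hR : (fun ω ↦ sideExpect κ Ψ (G ω) (stoppedValue (sleArgLevel κ n θ) ρ ω)) =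
      fun ω ↦ G ω * topExpect κ ψ (stoppedValue (sleArgLevel κ n θ) ρ ω) := by
    funext ω
    change sideExpect κ (fun (g : ℝ) t ν ↦ g * (ψ t * topInd ν)) (max (-C') (min C' (G ω)))
      (stoppedValue (sleArgLevel κ n θ) ρ ω) = _
    rw [sideExpect_top, hGclamp]
  rw [hL, hR] at h
  exact h

/-- **Strong Markov property, bottom exit**: `E[G · 1_{Y_T = 0} ψ(T - ρ)] = E[G · b_ψ(Y_ρ)]`,
`b_ψ(y) = E^y[ψ(T); Y_T = 0]`, the bottom half of LSW's (2.10).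
[cite: LawlerSchrammWernerEJP2002, §2 (2.10)] -/
theorem integral_mul_indicator_exitsBot_comp_sub_eq (hκ : 4 < κ)
    (hθn : θ ∈ Ioo (2 * level n) (2 * Real.pi - 2 * level n))
    {ρ : (ℝ≥0 → ℝ) → WithTop ℝ≥0} (hρ : IsStoppingTime brownianFiltration ρ)
    (hρσ : ∀ ω, ρ ω ≤ sleExitLevel κ n θ ω)
    {G : (ℝ≥0 → ℝ) → ℝ} (hG : Measurable[hρ.measurableSpace] G) {C' : ℝ} (hGb : ∀ ω, |G ω| ≤ C')
    {ψ : ℝ → ℝ} (hψm : Measurable ψ) {C : ℝ} (hψb : ∀ t, |ψ t| ≤ C) :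
    ∫ ω, G ω * (sleExitsBot κ θ).indicator
        (fun ω ↦ ψ (sleLifetimeReal κ θ ω - ((ρ ω).untopA : ℝ≥0))) ω ∂preWienerMeasure =
      ∫ ω, G ω * botExpect κ ψ (stoppedValue (sleArgLevel κ n θ) ρ ω) ∂preWienerMeasure := by
  have hC' : 0 ≤ C' := (abs_nonneg _).trans (hGb fun _ ↦ 0)
  set Ψ : ℝ → ℝ → ℝ → ℝ := fun g t ν ↦ max (-C') (min C' g) * (ψ t * botInd ν) with hΨ
  have hΨm : Measurable fun p : ℝ × ℝ × ℝ ↦ Ψ p.1 p.2.1 p.2.2 :=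
    (measurable_const.max (measurable_const.min measurable_fst)).mul
      ((hψm.comp measurable_snd.fst).mul (measurable_botInd.comp measurable_snd.snd))
  have hclamp : ∀ g : ℝ, |max (-C') (min C' g)| ≤ C' := fun g ↦
    abs_le.2 ⟨le_max_left _ _, max_le (by linarith) (min_le_left _ _)⟩
  have hC : 0 ≤ C := (abs_nonneg _).trans (hψb 0)
  have hΨb : ∀ g t ν, |Ψ g t ν| ≤ C' * C := by
    intro g t ν
    simp only [hΨ, abs_mul]
    have h1 : |botInd ν| ≤ 1 := by unfold botInd; split_ifs <;> simp
    calc |max (-C') (min C' g)| * (|ψ t| * |botInd ν|) ≤ C' * (C * 1) :=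
          mul_le_mul (hclamp g) (mul_le_mul (hψb t) h1 (abs_nonneg _) hC)
            (mul_nonneg (abs_nonneg _) (abs_nonneg _)) hC'
      _ = C' * C := by ring
  have h := integral_remainingLifetime_eq hκ hθn hρ hρσ hG hΨm hΨb
  have hGclamp : ∀ ω, max (-C') (min C' (G ω)) = G ω := fun ω ↦ by
    have := abs_le.1 (hGb ω)
    rw [min_eq_right this.2, max_eq_right this.1]
  have hL : (fun ω ↦ Ψ (G ω) (sleLifetimeReal κ θ ω - ((ρ ω).untopA : ℝ≥0)) (sleExitSign κ θ ω)) =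
      fun ω ↦ G ω * (sleExitsBot κ θ).indicator
        (fun ω ↦ ψ (sleLifetimeReal κ θ ω - ((ρ ω).untopA : ℝ≥0))) ω := by
    funext ω
    simp only [hΨ, hGclamp, botInd_sleExitSign]
    by_cases hω : ω ∈ sleExitsBot κ θ
    · simp [indicator_of_mem hω]
    · simp [indicator_of_notMem hω]
  have hR : (fun ω ↦ sideExpect κ Ψ (G ω) (stoppedValue (sleArgLevel κ n θ) ρ ω)) =
      fun ω ↦ G ω * botExpect κ ψ (stoppedValue (sleArgLevel κ n θ) ρ ω) := by
    funext ω
    change sideExpect κ (fun (g : ℝ) t ν ↦ g * (ψ t * botInd ν)) (max (-C') (min C' (G ω)))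
      (stoppedValue (sleArgLevel κ n θ) ρ ω) = _
    rw [sideExpect_bot, hGclamp]
  rw [hL, hR] at h
  exact h

end StrongMarkov


end RadialLoewner

end Literature.Probability.RandomPlanarGeometry
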